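/-
Copyright (c) 2026 the pub-hodgecm-mathlib formalisation cell (harness21).  Prover seat hodgecm-mathlib-K2E1-p09 (g4), Track B ∕ K2-LIT,
h413 = `stmt-HodgeConjecture-24833`, line `K2_E1_TraceFormulaBeta`, campaign RES-RANK-ONE, page «EIS-RANK-ONE»: «EIS-R6-prep» dealt by K2E1-plan (g3) 2026-09-04T04:32:53Z.
-/
import Summits.HodgeConjecture.HodgeConjecture.Theorems.K2E1BorelEisensteinUDefs            -- ★ p857359 (K2E1-p08 g4): `eisensteinSeriesU` over `Quotient (orbitRel ↥borelU ↥U(J_N)(F))`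
import Summits.HodgeConjecture.HodgeConjecture.Theorems.K2E1PseudoEisensteinConstantTermU    -- ★ p857274 (this seat) §1: `toAdelic_mem_borelAdelic_iff` (rational `borelU` ↔ adelic `borelAdelic`)
import Literature.NumberTheory.Automorphic.UnitaryGroupBorelTruncation                     -- ★ `arithmeticBorel`, `pseudoEisenstein` (Track A, `finsum` over `Quotient (rightRel B(F))`)
import Literature.NumberTheory.Automorphic.UnitaryGroupSingularBorelBasePoint               -- ★ `toAdelic_injective_quasiSplit`
import HarnessLib

/-!
# h413 ∕ Track B «K2-LIT», page EIS-RANK-ONE — `K2E1BorelCosetsDictionary` («EIS-R6-prep»): the Track-A index `B(F)\G(F) = Quotient (rightRel (arithmeticBorel F E c N))`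
# IS p08's index `Quotient (orbitRel ↥(borelU c J_N) ↥U(J_N)(F))`, with representatives compatible mod `B(F)` — so ★ `pseudoEisenstein ψ = eisensteinSeriesU ψ` on
# finitely-supported-mod-`B(F)` `ψ` and Arthur's ★ `truncation` meets the Eisenstein series of the campaign

Cell `pub/hodgecm-mathlib`, crux H413 = `stmt-HodgeConjecture-24833`, route `HCCMUnconditional`; dealer K2E1-plan (g3).  THEOREMS ONLY (no `def`, no `instance`, no `notation`, no
named-fact hypothesis, no `sorry`); lane `--kind proof --supports stmt-HodgeConjecture-24833 --as helper` (count-neutral).  Pure algebra, `N`-generic, typed over MOK's `quasiSplit F E c N`.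

THE DICTIONARY.  `ι_A : U(J_N)(F) ≃ G(F) = arithmeticSubgroup`, `γ ↦ ⟨ι γ, γ, rfl⟩` (★ `toAdelic_injective_quasiSplit`; built inline with `Equiv.ofBijective` — no new `def`); under `ι_A` the rational Borel
`borelU` goes to `arithmeticBorel = borelAdelic ⊓ G(F)` (§1), so `Quotient.congr ι_A` identifies the two coset spaces (§2, `[γ] ↦ [ι_A γ]`) and the `Quotient.out` representatives on the two
sides differ by an element of `B(F)` (§2 `exists_mem_arithmeticBorel_out_eq`); hence for left-`B(F)`-invariant `ψ` (the two spellings of that hypothesis are equivalent, §1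
`forall_arithmeticBorel_iff`) the Track-A `finsum` ★ `pseudoEisenstein ψ g` is the `finsum` over p08's index and p08's `tsum` ★ `eisensteinSeriesU ψ g` is the `tsum` over the Track-A index
(§3), and the two AGREE whenever the common term function `q ↦ ψ(q̃ g)` is finitely supported (§3 `pseudoEisenstein_eq_eisensteinSeriesU`, both finiteness currencies) — without finiteness
the `finsum` junk value `0` and the `tsum` need not agree, so the hypothesis is sharp for this junction.

HONEST LABEL.  Count-neutral helper; proves no printed statement; HC_CM is proved only modulo the 7 printed citations (2 remaining named inputs: hLiu418 =
`stmt-HodgeConjecture-24832`, h413 = `stmt-HodgeConjecture-24833`) until rung 0 closes.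

## References
* [Garrett2018] P. Garrett, *Modern Analysis of Automorphic Forms by Example* 1 (2018), §2.10 (pseudo-Eisenstein series over `P_k\G_k`).
* [MoeglinWaldspurger1995] C. Mœglin, J.-L. Waldspurger, *Spectral decomposition and Eisenstein series* (1995), II.1.5.
-/

set_option autoImplicit false
set_option linter.dupNamespace false  -- the mandated namespace repeats the summit's segment (`HodgeConjecture.HodgeConjecture`)

noncomputable section
open NumberField IsDedekindDomain Matrix MulAction
open Literature.NumberTheory.Automorphic Literature.NumberTheory.Automorphic.UnitaryGroup AdelicGroupData
open Summit.HodgeConjecture.HodgeConjecture.Cruxes.H413.K2E1BorelEisensteinU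
open Summit.HodgeConjecture.HodgeConjecture.Cruxes.H413.K2E1PseudoEisensteinConstantTermU
open scoped MatrixGroups

namespace Summit.HodgeConjecture.HodgeConjecture.Cruxes.H413.K2E1BorelCosetsDictionary

variable {F E : Type} [Field F] [NumberField F] [Field E] [NumberField E] [Algebra F E] {c : E ≃ₐ[F] E} {N : ℕ}

/-! ## §1 `ι_A : U(J_N)(F) ≃* G(F)` carries `borelU` to `arithmeticBorel`; the two spellings of «left-`B(F)`-invariant» -/

section Borel

/-- Every element of `G(F) = arithmeticSubgroup` is `ι(b)` for a unique rational `b`; the `B`-parts match: `γ ∈ arithmeticBorel ↔ b ∈ borelU` for `↑γ = ι(b)`. [cite: Garrett2018, §2.10] -/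
theorem mem_arithmeticBorel_iff_of_toAdelic_eq {γ : (quasiSplit F E c N).arithmeticSubgroup} {b : ↥(unitaryGroupOfForm (c : E →+* E) ((StdForm.antidiagonal N).over E))}
    (h : (quasiSplit F E c N).toAdelic b = (γ : (quasiSplit F E c N).Adelic)) :
    γ ∈ arithmeticBorel F E c N ↔ b ∈ borelU (c : E →+* E) ((StdForm.antidiagonal N).over E) := by
  rw [mem_arithmeticBorel_iff, ← h, K2E1PseudoEisensteinConstantTermU.toAdelic_mem_borelAdelic_iff]

/-- **THE TWO SPELLINGS OF «`ψ` IS LEFT-`B(F)`-INVARIANT» AGREE**: Track A's `∀ b ∈ arithmeticBorel, ψ(b x) = ψ(x)` (★ `pseudoEisenstein_term_eq`) ⟺ p08's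
`∀ b ∈ borelU, ψ(ι(b) x) = ψ(x)` (★ `eisensteinSeriesU_term_eq`). [cite: Garrett2018, §2.10] -/
theorem forall_arithmeticBorel_iff {M : Type*} {ψ : (quasiSplit F E c N).Adelic → M} :
    (∀ b ∈ arithmeticBorel F E c N, ∀ x : (quasiSplit F E c N).Adelic, ψ ((b : (quasiSplit F E c N).Adelic) * x) = ψ x) ↔
      ∀ b ∈ borelU (c : E →+* E) ((StdForm.antidiagonal N).over E), ∀ x : (quasiSplit F E c N).Adelic, ψ ((quasiSplit F E c N).toAdelic b * x) = ψ x := by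
  constructor
  · intro h b hb x
    exact h ⟨(quasiSplit F E c N).toAdelic b, b, rfl⟩ ((mem_arithmeticBorel_iff_of_toAdelic_eq rfl).2 hb) x
  · intro h γ hγ x
    obtain ⟨b, hb⟩ := MonoidHom.mem_range.1 γ.2
    rw [← hb]
    exact h b ((mem_arithmeticBorel_iff_of_toAdelic_eq hb).1 hγ) x

end Borel

/-! ## §2 The coset dictionary `κ : B(F)\U(J_N)(F) ≃ B(F)\G(F)` and the compatibility of representatives -/

section Cosets

/-- **THE COSET DICTIONARY**: an equivalence `κ` from p08's index `Quotient (orbitRel ↥borelU ↥U(J_N)(F))` (★ p857160; = Mathlib `rightRel borelU`) to Track A's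
`Quotient (rightRel (arithmeticBorel F E c N))` with `κ [γ] = [ι_A γ]` — `Quotient.congr` along the group isomorphism `ι_A`, the relations matching by §1
(`δ γ⁻¹ ∈ borelU ↔ ι_A(δ γ⁻¹) ∈ arithmeticBorel`). [cite: Garrett2018, §2.10] -/
theorem exists_equiv_arithmeticBorelQuot :
    ∃ κ : Quotient (orbitRel ↥(borelU (c : E →+* E) ((StdForm.antidiagonal N).over E)) ↥(unitaryGroupOfForm (c : E →+* E) ((StdForm.antidiagonal N).over E))) ≃
        Quotient (QuotientGroup.rightRel (arithmeticBorel F E c N)),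
      ∀ γ : ↥(unitaryGroupOfForm (c : E →+* E) ((StdForm.antidiagonal N).over E)),
        κ (Quotient.mk _ γ) = Quotient.mk (QuotientGroup.rightRel (arithmeticBorel F E c N))
          (⟨(quasiSplit F E c N).toAdelic γ, γ, rfl⟩ : (quasiSplit F E c N).arithmeticSubgroup) := by
  -- `ι_A : U(J_N)(F) ≃ G(F)`, `γ ↦ ⟨ι γ, γ, rfl⟩`
  let e : ↥(unitaryGroupOfForm (c : E →+* E) ((StdForm.antidiagonal N).over E)) ≃ (quasiSplit F E c N).arithmeticSubgroup :=
    Equiv.ofBijective (fun γ => (⟨(quasiSplit F E c N).toAdelic γ, γ, rfl⟩ : (quasiSplit F E c N).arithmeticSubgroup))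
      ⟨fun a b h => toAdelic_injective_quasiSplit (congrArg Subtype.val h), fun γ => by
        obtain ⟨g, hg⟩ := MonoidHom.mem_range.1 γ.2; exact ⟨g, Subtype.ext hg⟩⟩
  have he : ∀ γ, (e γ : (quasiSplit F E c N).Adelic) = (quasiSplit F E c N).toAdelic γ := fun _ => rfl
  refine ⟨Quotient.congr e fun a b => ?_, fun γ => rfl⟩
  change @Setoid.r _ (QuotientGroup.rightRel (borelU (c : E →+* E) ((StdForm.antidiagonal N).over E))) a b ↔
    @Setoid.r _ (QuotientGroup.rightRel (arithmeticBorel F E c N)) (e a) (e b)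
  rw [QuotientGroup.rightRel_apply, QuotientGroup.rightRel_apply, mem_arithmeticBorel_iff, Subgroup.coe_mul, Subgroup.coe_inv, he, he, ← map_inv,
    ← toAdelic_mul_quasiSplit, K2E1PseudoEisensteinConstantTermU.toAdelic_mem_borelAdelic_iff]
  exact Iff.rfl

/-- **COMPATIBILITY OF REPRESENTATIVES MOD `B(F)`**: for any dictionary `κ` with `κ [γ] = [ι_A γ]`, the Track-A representative of `κ q` is `β · ι_A(q.out)` with `β ∈ arithmeticBorel`
(both represent the same right coset). [cite: Garrett2018, §2.10] -/
theorem exists_mem_arithmeticBorel_out_eq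
    (κ : Quotient (orbitRel ↥(borelU (c : E →+* E) ((StdForm.antidiagonal N).over E)) ↥(unitaryGroupOfForm (c : E →+* E) ((StdForm.antidiagonal N).over E))) ≃
      Quotient (QuotientGroup.rightRel (arithmeticBorel F E c N)))
    (hκ : ∀ γ : ↥(unitaryGroupOfForm (c : E →+* E) ((StdForm.antidiagonal N).over E)),
      κ (Quotient.mk _ γ) = Quotient.mk (QuotientGroup.rightRel (arithmeticBorel F E c N))
        (⟨(quasiSplit F E c N).toAdelic γ, γ, rfl⟩ : (quasiSplit F E c N).arithmeticSubgroup))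
    (q : Quotient (orbitRel ↥(borelU (c : E →+* E) ((StdForm.antidiagonal N).over E)) ↥(unitaryGroupOfForm (c : E →+* E) ((StdForm.antidiagonal N).over E)))) :
    ∃ β ∈ arithmeticBorel F E c N, ((κ q).out : (quasiSplit F E c N).arithmeticSubgroup) =
      β * (⟨(quasiSplit F E c N).toAdelic q.out, q.out, rfl⟩ : (quasiSplit F E c N).arithmeticSubgroup) := by
  have hq : κ q = Quotient.mk (QuotientGroup.rightRel (arithmeticBorel F E c N))
      (⟨(quasiSplit F E c N).toAdelic q.out, q.out, rfl⟩ : (quasiSplit F E c N).arithmeticSubgroup) := by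
    conv_lhs => rw [← Quotient.out_eq q]
    exact hκ q.out
  have hrel : @Setoid.r _ (QuotientGroup.rightRel (arithmeticBorel F E c N)) (κ q).out
      (⟨(quasiSplit F E c N).toAdelic q.out, q.out, rfl⟩ : (quasiSplit F E c N).arithmeticSubgroup) := by
    rw [hq]; exact Quotient.mk_out (s := QuotientGroup.rightRel (arithmeticBorel F E c N)) _
  rw [QuotientGroup.rightRel_apply] at hrel
  exact ⟨_, Subgroup.inv_mem _ hrel, by group⟩

/-- **THE TERMS MATCH**: for `ψ` left-`B(F)`-invariant (Track-A spelling) and any dictionary `κ`, `ψ((κ q).out · g) = ψ(ι(q.out) · g)`. [cite: Garrett2018, §2.10] -/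
theorem apply_out_eq {M : Type*} {ψ : (quasiSplit F E c N).Adelic → M}
    (hψ : ∀ b ∈ arithmeticBorel F E c N, ∀ x : (quasiSplit F E c N).Adelic, ψ ((b : (quasiSplit F E c N).Adelic) * x) = ψ x)
    (κ : Quotient (orbitRel ↥(borelU (c : E →+* E) ((StdForm.antidiagonal N).over E)) ↥(unitaryGroupOfForm (c : E →+* E) ((StdForm.antidiagonal N).over E))) ≃
      Quotient (QuotientGroup.rightRel (arithmeticBorel F E c N)))
    (hκ : ∀ γ : ↥(unitaryGroupOfForm (c : E →+* E) ((StdForm.antidiagonal N).over E)),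
      κ (Quotient.mk _ γ) = Quotient.mk (QuotientGroup.rightRel (arithmeticBorel F E c N))
        (⟨(quasiSplit F E c N).toAdelic γ, γ, rfl⟩ : (quasiSplit F E c N).arithmeticSubgroup))
    (q : Quotient (orbitRel ↥(borelU (c : E →+* E) ((StdForm.antidiagonal N).over E)) ↥(unitaryGroupOfForm (c : E →+* E) ((StdForm.antidiagonal N).over E))))
    (g : (quasiSplit F E c N).Adelic) :
    ψ ((((κ q).out : (quasiSplit F E c N).arithmeticSubgroup) : (quasiSplit F E c N).Adelic) * g) =
      ψ ((quasiSplit F E c N).toAdelic (q.out : ↥(unitaryGroupOfForm (c : E →+* E) ((StdForm.antidiagonal N).over E))) * g) := by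
  obtain ⟨β, hβ, h⟩ := exists_mem_arithmeticBorel_out_eq κ hκ q
  rw [h, Subgroup.coe_mul, mul_assoc]
  exact hψ β hβ _

end Cosets

/-! ## §3 `pseudoEisenstein` over p08's index, `eisensteinSeriesU` over Track A's index, and `pseudoEisenstein = eisensteinSeriesU` on finitely supported terms -/

section Sums

/-- **★ `pseudoEisenstein` AS A `finsum` OVER p08's INDEX**: for left-`B(F)`-invariant `ψ`, `pseudoEisenstein ψ g = Σᶠ_{q ∈ B(F)\U(J_N)(F)} ψ(ι(q.out) g)` (Mathlib `finsum_comp_equiv`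
along the dictionary of §2). [cite: Garrett2018, §2.10] -/
theorem pseudoEisenstein_eq_finsum_borelUQuot {ψ : (quasiSplit F E c N).Adelic → ℂ}
    (hψ : ∀ b ∈ arithmeticBorel F E c N, ∀ x : (quasiSplit F E c N).Adelic, ψ ((b : (quasiSplit F E c N).Adelic) * x) = ψ x) (g : (quasiSplit F E c N).Adelic) :
    pseudoEisenstein ψ g = ∑ᶠ q : Quotient (orbitRel ↥(borelU (c : E →+* E) ((StdForm.antidiagonal N).over E)) ↥(unitaryGroupOfForm (c : E →+* E) ((StdForm.antidiagonal N).over E))),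
      ψ ((quasiSplit F E c N).toAdelic (q.out : ↥(unitaryGroupOfForm (c : E →+* E) ((StdForm.antidiagonal N).over E))) * g) := by
  obtain ⟨κ, hκ⟩ := exists_equiv_arithmeticBorelQuot (F := F) (E := E) (c := c) (N := N)
  rw [pseudoEisenstein_def, ← finsum_comp_equiv κ]
  exact finsum_congr fun q => apply_out_eq hψ κ hκ q g

/-- **★ `eisensteinSeriesU` AS A `tsum` OVER TRACK A's INDEX**: for left-`B(F)`-invariant `ψ`, `eisensteinSeriesU ψ g = Σ'_{q ∈ Quotient (rightRel arithmeticBorel)} ψ(q.out g)`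
(Mathlib `Equiv.tsum_eq` along §2). [cite: MoeglinWaldspurger1995, II.1.5] -/
theorem eisensteinSeriesU_eq_tsum_arithmeticBorelQuot {ψ : (quasiSplit F E c N).Adelic → ℂ}
    (hψ : ∀ b ∈ arithmeticBorel F E c N, ∀ x : (quasiSplit F E c N).Adelic, ψ ((b : (quasiSplit F E c N).Adelic) * x) = ψ x) (g : (quasiSplit F E c N).Adelic) :
    eisensteinSeriesU ψ g = ∑' q : Quotient (QuotientGroup.rightRel (arithmeticBorel F E c N)),
      ψ (((q.out : (quasiSplit F E c N).arithmeticSubgroup) : (quasiSplit F E c N).Adelic) * g) := by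
  obtain ⟨κ, hκ⟩ := exists_equiv_arithmeticBorelQuot (F := F) (E := E) (c := c) (N := N)
  rw [eisensteinSeriesU_def, ← κ.tsum_eq]
  exact tsum_congr fun q => (apply_out_eq hψ κ hκ q g).symm

/-- **★ `pseudoEisenstein ψ = eisensteinSeriesU ψ` ON FINITELY-SUPPORTED-MOD-`B(F)` DATA** (finiteness in p08's index): if `ψ` is left-`B(F)`-invariant and `q ↦ ψ(ι(q.out) g)` has finite support
on `B(F)\U(J_N)(F)`, the Track-A `finsum` and p08's `tsum` agree at `g` (Mathlib `tsum_eq_finsum`).  The finiteness is what «`ψ` compactly supported mod `B(F)N(𝔸)`» delivers pointwise in `g`;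
without it the junk conventions differ. [cite: Garrett2018, §2.10] -/
theorem pseudoEisenstein_eq_eisensteinSeriesU {ψ : (quasiSplit F E c N).Adelic → ℂ}
    (hψ : ∀ b ∈ arithmeticBorel F E c N, ∀ x : (quasiSplit F E c N).Adelic, ψ ((b : (quasiSplit F E c N).Adelic) * x) = ψ x) (g : (quasiSplit F E c N).Adelic)
    (hfin : (Function.support fun q : Quotient (orbitRel ↥(borelU (c : E →+* E) ((StdForm.antidiagonal N).over E)) ↥(unitaryGroupOfForm (c : E →+* E) ((StdForm.antidiagonal N).over E))) =>
      ψ ((quasiSplit F E c N).toAdelic (q.out : ↥(unitaryGroupOfForm (c : E →+* E) ((StdForm.antidiagonal N).over E))) * g)).Finite) :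
    pseudoEisenstein ψ g = eisensteinSeriesU ψ g := by
  rw [pseudoEisenstein_eq_finsum_borelUQuot hψ g, eisensteinSeriesU_def]
  exact (tsum_eq_finsum hfin).symm

/-- **★ `pseudoEisenstein ψ = eisensteinSeriesU ψ`**, finiteness in Track A's index `Quotient (rightRel arithmeticBorel)`. [cite: Garrett2018, §2.10] -/
theorem pseudoEisenstein_eq_eisensteinSeriesU' {ψ : (quasiSplit F E c N).Adelic → ℂ}
    (hψ : ∀ b ∈ arithmeticBorel F E c N, ∀ x : (quasiSplit F E c N).Adelic, ψ ((b : (quasiSplit F E c N).Adelic) * x) = ψ x) (g : (quasiSplit F E c N).Adelic)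
    (hfin : (Function.support fun q : Quotient (QuotientGroup.rightRel (arithmeticBorel F E c N)) =>
      ψ (((q.out : (quasiSplit F E c N).arithmeticSubgroup) : (quasiSplit F E c N).Adelic) * g)).Finite) :
    pseudoEisenstein ψ g = eisensteinSeriesU ψ g := by
  rw [pseudoEisenstein_def, eisensteinSeriesU_eq_tsum_arithmeticBorelQuot hψ g]
  exact (tsum_eq_finsum hfin).symm

/-- The same junction in p08's spelling of the invariance hypothesis (`∀ b ∈ borelU, ψ(ι(b) x) = ψ(x)`), finiteness in p08's index. [cite: Garrett2018, §2.10] -/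
theorem pseudoEisenstein_eq_eisensteinSeriesU_of_borelU {ψ : (quasiSplit F E c N).Adelic → ℂ}
    (hψ : ∀ b ∈ borelU (c : E →+* E) ((StdForm.antidiagonal N).over E), ∀ x : (quasiSplit F E c N).Adelic, ψ ((quasiSplit F E c N).toAdelic b * x) = ψ x)
    (g : (quasiSplit F E c N).Adelic)
    (hfin : (Function.support fun q : Quotient (orbitRel ↥(borelU (c : E →+* E) ((StdForm.antidiagonal N).over E)) ↥(unitaryGroupOfForm (c : E →+* E) ((StdForm.antidiagonal N).over E))) =>
      ψ ((quasiSplit F E c N).toAdelic (q.out : ↥(unitaryGroupOfForm (c : E →+* E) ((StdForm.antidiagonal N).over E))) * g)).Finite) :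
    pseudoEisenstein ψ g = eisensteinSeriesU ψ g :=
  pseudoEisenstein_eq_eisensteinSeriesU (forall_arithmeticBorel_iff.2 hψ) g hfin

end Sums

end Summit.HodgeConjecture.HodgeConjecture.Cruxes.H413.K2E1BorelCosetsDictionary

end
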